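import Summits.MatrixMultiplication.MatrixMultiplication.Theorems.FarEdgeDescentChainCapSteps

/-!
# Far-edge descent, kernel XLI-A — the floor-constrained dial is capped at Schönhage's order on EVERY product tree, given a two-share pair criterion (model level)

Kernel XL-B (`FarEdgeDescentChainCap`) capped the β-dial of kernels XXXVIII/XXXIX along CHAIN
schedules; memo NODE-g60 §3 left general binary product trees (deep object × deep object) open and
recorded the obstruction its potential `λ(1−min(V,V†))^γ` meets there (unreachable small-share,
degraded partner states).  This file removes the obstruction by changing the potential to a LINEAR
one and proves the tree cap for every `(β, ε, V_min)` satisfying an explicit PAIR CRITERION in the two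
shares only.

THE LEVER: the potential is EXTENSIVE.  For an anchored object with anchor `Q`, leg mass `L`, narrow
(width-`a`) leg mass `N` and size proxy `r = Q + βL` (multiplicative under `⊗`), put
`λ = L/r` (share), `w = (L − N)/r` (WIDE share, `= λ(1−V)` with `V = N/L` the depth-2 narrowness of
XL-A at `z = 0`) and `Φ = w + ε·λ`.  Under the product both obey EXACT bilinear rules
`λ_P = λ + λ' − (2β−1)λλ'`, `w_P = (1−βλ')w + (1−βλ)w' + λλ'`, hence
`Φ_P = (1−βλ')Φ + (1−βλ)Φ' + (1+ε)λλ'`, while the first-order deviation obeys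
`y_P = (1−(β−1)λ')y + (1−(β−1)λ)y'` and the size is additive.  The depth-2 node floor `V ≥ V_min` reads
`w_P ≤ (1−V_min)λ_P`.  CLAIM (`tree_cap`): along every floor-respecting product tree over heavy bases
(share `μ ≤ 1/(2β−1)`, deviation `≤ R·μ`, size `≥ ℓ_min > 0`)
`y(T) ≤ R/(ε·ℓ_min^{κ_S}) · Φ(T) · size(T)^{κ_S}`, `κ_S = log₂(4/3)`,
PROVIDED the pair criterion holds: for all shares `λ, λ' ∈ (0, 1/(2β−1)]`, all `0 ≤ Φ ≤ Mλ`,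
`0 ≤ Φ' ≤ Mλ'` (`M = 1+ε−V_min`) with `Φ_P ≤ M·λ_P` and all `x ∈ [0,1]`:
`(1−(β−1)λ')·Φ·x^{κ_S} + (1−(β−1)λ)·Φ'·(1−x)^{κ_S} ≤ Φ_P`.
The proof is a three-line structural induction (a leaf has `Φ = εμ`; at a node put
`x = size/(size+size')`); all the content is in the criterion, which involves NO narrowness, NO
reachability and NO size — the Hölder split in the size ratio is free.  Kernel XLI-B
(`FarEdgeDescentTreeCapTools`) reduces the criterion to a one-line-per-point inequality at two explicit
vertices and supplies the tangent (dyadic) bounds `x^{κ_S} ≤ (1−κ_S)x₀^{κ_S} + κ_S x₀^{κ_S−1}x`;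
memo NODE-g61 §2 reports the criterion's margins (`β = 3/2`, `V_min = 1/7`, `ε = 1/100`: worst exact
ratio `0.956` off the neutral direction `λ' → 0`, where it tends to `1⁻` with first-order margin
`λ'(λV + ε(1−βλ))`).

HONEST FRAMING: MODEL level — statements about real-labelled binary trees obeying the dial's product
clauses (the clauses are theorems about `Sched` of XL-D: `share_node`, `dev_node`, `legMass_node`, and
the width-`a` leg mass obeys `N_P = Q·N' + Q'·N`); nothing about tensors, `ω(1,k,1)` or
`AnchoredLogConvexity`; no `sorry`, no axioms.  Bases are HEAVY (`b ≥ β−1`) as in XL-B; light bases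
need a reachability invariant (memo §3).  References: Schönhage 1981, Thm. 3 [Schonhage1981];
Coppersmith–Winograd 1982 [CoppersmithWinograd1982]; Landsberg–Ottaviani 2015 [LandsbergOttaviani2015];
kernels XL-A/B/D, memo NODE-g60 §3/§5.
-/

noncomputable section

set_option linter.dupNamespace false

namespace Summit.MatrixMultiplication.MatrixMultiplication.Theorems.FarEdgeDescentTreeCap

open Summit.MatrixMultiplication.MatrixMultiplication.Theorems.FarEdgeDescentChainCapSteps

/-! ## The product-tree model -/

/-- Binary product trees over bases labelled by (share `μ`, deviation `yb`, size `ℓb`). -/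
inductive PTree : Type
  | leaf (μ yb ℓb : ℝ) : PTree
  | node (s t : PTree) : PTree

namespace PTree

/-- Share `λ = L/(Q+βL)`: a base has its own share, a product `λ + λ' − (2β−1)λλ'`. -/
def share (β : ℝ) : PTree → ℝ
  | leaf μ _ _ => μ
  | node s t => share β s + share β t - (2 * β - 1) * share β s * share β t

/-- Wide share `w = (L − N)/(Q + βL)` (`N` = leg mass at the base width): a base has none, a product
`(1−βλ')w + (1−βλ)w' + λλ'`. -/
def wide (β : ℝ) : PTree → ℝ
  | leaf _ _ _ => 0
  | node s t => (1 - β * share β t) * wide β s + (1 - β * share β s) * wide β t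
      + share β s * share β t

/-- First-order deviation: base value `yb`, product `(1−(β−1)λ')y + (1−(β−1)λ)y'`. -/
def dev (β : ℝ) : PTree → ℝ
  | leaf _ yb _ => yb
  | node s t => (1 - (β - 1) * share β t) * dev β s + (1 - (β - 1) * share β s) * dev β t

/-- Additive size, base value `ℓb`. -/
def size : PTree → ℝ
  | leaf _ _ ℓb => ℓb
  | node s t => size s + size t

/-- The linear potential `Φ = w + ε·λ`. -/
def pot (β ε : ℝ) (T : PTree) : ℝ := wide β T + ε * share β T

/-- Admissible trees: heavy bases (`0 < μ`, `(2β−1)μ ≤ 1`) with deviation `0 ≤ yb ≤ R·μ` and size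
`ℓb ≥ ℓ_min`; every product node passes the depth-2 floor `w ≤ (1 − V_min)·λ` (`V ≥ V_min`). -/
def Adm (β Vmin R ℓmin : ℝ) : PTree → Prop
  | leaf μ yb ℓb => 0 < μ ∧ (2 * β - 1) * μ ≤ 1 ∧ 0 ≤ yb ∧ yb ≤ R * μ ∧ ℓmin ≤ ℓb
  | node s t => Adm β Vmin R ℓmin s ∧ Adm β Vmin R ℓmin t ∧
      wide β (node s t) ≤ (1 - Vmin) * share β (node s t)

end PTree

open PTree

/-! ## Invariants -/

/-- The product rule of the potential: `Φ_P = (1−βλ')Φ + (1−βλ)Φ' + (1+ε)λλ'`. -/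
theorem pot_node (β ε : ℝ) (s t : PTree) :
    pot β ε (node s t) = (1 - β * share β t) * pot β ε s + (1 - β * share β s) * pot β ε t
      + (1 + ε) * share β s * share β t := by
  simp only [pot, wide, share]
  ring

/-- Shares stay in the heavy window `(0, 1/(2β−1)]`, the wide share in `[0, λ]`, deviations are
nonnegative and sizes at least `ℓ_min`, along every admissible tree. -/
theorem adm_invariants {β Vmin R ℓmin : ℝ} (hβ : 1 ≤ β) (hR : 0 ≤ R) (hℓ : 0 < ℓmin) :
    ∀ T : PTree, Adm β Vmin R ℓmin T →
      (0 < share β T ∧ (2 * β - 1) * share β T ≤ 1) ∧ (0 ≤ wide β T ∧ wide β T ≤ share β T) ∧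
      0 ≤ dev β T ∧ ℓmin ≤ size T
  | leaf μ yb ℓb, h => by
      obtain ⟨hμ0, hμ1, hy0, _, hℓb⟩ := h
      exact ⟨⟨hμ0, hμ1⟩, ⟨le_rfl, hμ0.le⟩, hy0, hℓb⟩
  | node s t, h => by
      obtain ⟨hs, ht, _⟩ := h
      obtain ⟨⟨hls0, hls1⟩, ⟨hws0, hws1⟩, hds, hℓs⟩ := adm_invariants hβ hR hℓ s hs
      obtain ⟨⟨hlt0, hlt1⟩, ⟨hwt0, hwt1⟩, hdt, hℓt⟩ := adm_invariants hβ hR hℓ t ht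
      have hqs : 0 ≤ 1 - β * share β s := by nlinarith
      have hqt : 0 ≤ 1 - β * share β t := by nlinarith
      have hns : 0 ≤ 1 - (β - 1) * share β s := by nlinarith
      have hnt : 0 ≤ 1 - (β - 1) * share β t := by nlinarith
      refine ⟨⟨?_, ?_⟩, ⟨?_, ?_⟩, ?_, ?_⟩
      · show 0 < share β s + share β t - (2 * β - 1) * share β s * share β t
        have : 0 ≤ share β t * (1 - (2 * β - 1) * share β s) := mul_nonneg hlt0.le (by linarith)
        nlinarith
      · show (2 * β - 1) * (share β s + share β t - (2 * β - 1) * share β s * share β t) ≤ 1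
        nlinarith [mul_nonneg (sub_nonneg.2 hls1) (sub_nonneg.2 hlt1)]
      · show 0 ≤ (1 - β * share β t) * wide β s + (1 - β * share β s) * wide β t
          + share β s * share β t
        have := mul_nonneg hqt hws0
        have := mul_nonneg hqs hwt0
        have := mul_nonneg hls0.le hlt0.le
        linarith
      · show (1 - β * share β t) * wide β s + (1 - β * share β s) * wide β t
          + share β s * share β t ≤ share β s + share β t - (2 * β - 1) * share β s * share β t
        have h1 := mul_le_mul_of_nonneg_left hws1 hqt
        have h2 := mul_le_mul_of_nonneg_left hwt1 hqs
        nlinarith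
      · show 0 ≤ (1 - (β - 1) * share β t) * dev β s + (1 - (β - 1) * share β s) * dev β t
        have := mul_nonneg hnt hds
        have := mul_nonneg hns hdt
        linarith
      · show ℓmin ≤ size s + size t
        linarith

/-- The potential of an admissible tree lies in `[ε·λ, (1+ε−V_min)·λ]` at a product node and equals
`ε·μ` at a base; in particular `0 ≤ Φ ≤ (1+ε−V_min)·λ` whenever `V_min ≤ 1`. -/
theorem pot_bounds {β Vmin R ℓmin ε : ℝ} (hβ : 1 ≤ β) (hR : 0 ≤ R) (hℓ : 0 < ℓmin) (hε : 0 ≤ ε)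
    (hV1 : Vmin ≤ 1) (T : PTree) (hT : Adm β Vmin R ℓmin T) :
    0 ≤ pot β ε T ∧ pot β ε T ≤ (1 + ε - Vmin) * share β T := by
  obtain ⟨⟨hl0, _⟩, ⟨hw0, _⟩, _, _⟩ := adm_invariants hβ hR hℓ T hT
  refine ⟨by unfold pot; positivity, ?_⟩
  cases T with
  | leaf μ yb ℓb =>
      show 0 + ε * μ ≤ (1 + ε - Vmin) * μ
      have : 0 ≤ (1 - Vmin) * μ := mul_nonneg (by linarith) hl0.le
      linarith
  | node s t =>
      have hfl : wide β (node s t) ≤ (1 - Vmin) * share β (node s t) := hT.2.2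
      show wide β (node s t) + ε * share β (node s t) ≤ (1 + ε - Vmin) * share β (node s t)
      linarith

/-! ## The tree cap -/

set_option maxHeartbeats 400000 in
/-- **Tree cap from the pair criterion.**  If `1 ≤ β`, `0 < ε`, `0 ≤ V_min ≤ 1`, `0 ≤ R`,
`0 < ℓ_min` and the PAIR CRITERION holds — for all heavy shares `λ, λ'`, potentials
`0 ≤ Φ ≤ (1+ε−V_min)λ`, `0 ≤ Φ' ≤ (1+ε−V_min)λ'` whose product passes the floor
(`Φ_P ≤ (1+ε−V_min)λ_P`) and all size ratios `x ∈ [0,1]`,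
`(1−(β−1)λ')Φ·x^{κ_S} + (1−(β−1)λ)Φ'·(1−x)^{κ_S} ≤ Φ_P` — then along EVERY admissible product tree
`y(T) ≤ R/(ε·ℓ_min^{κ_S}) · Φ(T) · size(T)^{κ_S}`. -/
theorem tree_cap {β ε Vmin R ℓmin : ℝ} (hβ : 1 ≤ β) (hε : 0 < ε) (hV0 : 0 ≤ Vmin) (hV1 : Vmin ≤ 1)
    (hR : 0 ≤ R) (hℓ : 0 < ℓmin)
    (hcrit : ∀ lA lB PA PB x : ℝ, 0 < lA → (2 * β - 1) * lA ≤ 1 → 0 < lB → (2 * β - 1) * lB ≤ 1 →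
      0 ≤ PA → PA ≤ (1 + ε - Vmin) * lA → 0 ≤ PB → PB ≤ (1 + ε - Vmin) * lB →
      (1 - β * lB) * PA + (1 - β * lA) * PB + (1 + ε) * lA * lB ≤
        (1 + ε - Vmin) * (lA + lB - (2 * β - 1) * lA * lB) →
      0 ≤ x → x ≤ 1 →
      (1 - (β - 1) * lB) * PA * x ^ (Real.log (4 / 3) / Real.log 2) +
          (1 - (β - 1) * lA) * PB * (1 - x) ^ (Real.log (4 / 3) / Real.log 2) ≤
        (1 - β * lB) * PA + (1 - β * lA) * PB + (1 + ε) * lA * lB) :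
    ∀ T : PTree, Adm β Vmin R ℓmin T →
      dev β T ≤ R / (ε * ℓmin ^ (Real.log (4 / 3) / Real.log 2)) * pot β ε T *
        size T ^ (Real.log (4 / 3) / Real.log 2)
  | leaf μ yb ℓb, h => by
      obtain ⟨hμ0, _, _, hyR, hℓb⟩ := h
      set κ := Real.log (4 / 3) / Real.log 2 with hκ
      have hκ0 : 0 ≤ κ := kappaS_nonneg
      have hℓb0 : 0 < ℓb := lt_of_lt_of_le hℓ hℓb
      have hpow : ℓmin ^ κ ≤ ℓb ^ κ := Real.rpow_le_rpow hℓ.le hℓb hκ0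
      have hmin : 0 < ℓmin ^ κ := Real.rpow_pos_of_pos hℓ κ
      show yb ≤ R / (ε * ℓmin ^ κ) * (0 + ε * μ) * ℓb ^ κ
      have h1 : R / (ε * ℓmin ^ κ) * (0 + ε * μ) * ℓb ^ κ = R * μ * (ℓb ^ κ / ℓmin ^ κ) := by
        field_simp
        ring
      rw [h1]
      have h2 : 1 ≤ ℓb ^ κ / ℓmin ^ κ := by rw [le_div_iff₀ hmin]; linarith
      have h3 : 0 ≤ R * μ := mul_nonneg hR hμ0.le
      nlinarith
  | node s t, h => by
      obtain ⟨hs, ht, hfl⟩ := h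
      set κ := Real.log (4 / 3) / Real.log 2 with hκ
      have hκ0 : 0 ≤ κ := kappaS_nonneg
      have ihs := tree_cap hβ hε hV0 hV1 hR hℓ hcrit s hs
      have iht := tree_cap hβ hε hV0 hV1 hR hℓ hcrit t ht
      obtain ⟨⟨hls0, hls1⟩, _, _, hℓs⟩ := adm_invariants hβ hR hℓ s hs
      obtain ⟨⟨hlt0, hlt1⟩, _, _, hℓt⟩ := adm_invariants hβ hR hℓ t ht
      obtain ⟨hPs0, hPs1⟩ := pot_bounds hβ hR hℓ hε.le hV1 s hs
      obtain ⟨hPt0, hPt1⟩ := pot_bounds hβ hR hℓ hε.le hV1 t ht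
      have hsz_s : 0 < size s := lt_of_lt_of_le hℓ hℓs
      have hsz_t : 0 < size t := lt_of_lt_of_le hℓ hℓt
      have hsz : 0 < size s + size t := by linarith
      set U := R / (ε * ℓmin ^ κ) with hU
      have hU0 : 0 ≤ U := div_nonneg hR (mul_nonneg hε.le (Real.rpow_nonneg hℓ.le κ))
      have hns : 0 ≤ 1 - (β - 1) * share β s := by nlinarith
      have hnt : 0 ≤ 1 - (β - 1) * share β t := by nlinarith
      -- the floor at the node, in potential form
      have hflP : (1 - β * share β t) * pot β ε s + (1 - β * share β s) * pot β ε t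
          + (1 + ε) * share β s * share β t ≤
          (1 + ε - Vmin) * (share β s + share β t - (2 * β - 1) * share β s * share β t) := by
        have := (pot_bounds hβ hR hℓ hε.le hV1 (node s t) ⟨hs, ht, hfl⟩).2
        rw [pot_node] at this
        exact this
      -- the size ratio
      set x := size s / (size s + size t) with hx
      have hx0 : 0 ≤ x := div_nonneg hsz_s.le hsz.le
      have hx1 : x ≤ 1 := by rw [hx, div_le_one hsz]; linarith
      have hxs : size s = x * (size s + size t) := by rw [hx]; field_simp
      have hxt : size t = (1 - x) * (size s + size t) := by rw [hx]; field_simp; ring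
      have hpow_s : size s ^ κ = x ^ κ * (size s + size t) ^ κ := by
        rw [hxs, Real.mul_rpow hx0 hsz.le, ← hxs]
      have hpow_t : size t ^ κ = (1 - x) ^ κ * (size s + size t) ^ κ := by
        rw [hxt, Real.mul_rpow (by linarith) hsz.le, ← hxt]
      have hC := hcrit (share β s) (share β t) (pot β ε s) (pot β ε t) x hls0 hls1 hlt0 hlt1
        hPs0 hPs1 hPt0 hPt1 hflP hx0 hx1
      have hS0 : 0 ≤ (size s + size t) ^ κ := Real.rpow_nonneg hsz.le κ
      -- assemble
      show (1 - (β - 1) * share β t) * dev β s + (1 - (β - 1) * share β s) * dev β t ≤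
        U * pot β ε (node s t) * (size s + size t) ^ κ
      rw [pot_node]
      have h1 : (1 - (β - 1) * share β t) * dev β s ≤
          (1 - (β - 1) * share β t) * (U * pot β ε s * size s ^ κ) :=
        mul_le_mul_of_nonneg_left ihs hnt
      have h2 : (1 - (β - 1) * share β s) * dev β t ≤
          (1 - (β - 1) * share β s) * (U * pot β ε t * size t ^ κ) :=
        mul_le_mul_of_nonneg_left iht hns
      have h3 := mul_le_mul_of_nonneg_left (mul_le_mul_of_nonneg_right hC hS0) hU0
      rw [hpow_s] at h1
      rw [hpow_t] at h2
      nlinarith [h1, h2, h3]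

/-- **Corollary: the cap with one constant.**  Under the hypotheses of `tree_cap`, every admissible
product tree has `y(T) ≤ C · size(T)^{κ_S}` with `C = R(1+ε)/(ε(2β−1)) · ℓ_min^{−κ_S}` — no
schedule of products over heavy bases, however branched, amplifies faster than Schönhage's order. -/
theorem tree_cap_uniform {β ε Vmin R ℓmin : ℝ} (hβ : 1 ≤ β) (hε : 0 < ε) (hV0 : 0 ≤ Vmin)
    (hV1 : Vmin ≤ 1) (hR : 0 ≤ R) (hℓ : 0 < ℓmin)
    (hcrit : ∀ lA lB PA PB x : ℝ, 0 < lA → (2 * β - 1) * lA ≤ 1 → 0 < lB → (2 * β - 1) * lB ≤ 1 →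
      0 ≤ PA → PA ≤ (1 + ε - Vmin) * lA → 0 ≤ PB → PB ≤ (1 + ε - Vmin) * lB →
      (1 - β * lB) * PA + (1 - β * lA) * PB + (1 + ε) * lA * lB ≤
        (1 + ε - Vmin) * (lA + lB - (2 * β - 1) * lA * lB) →
      0 ≤ x → x ≤ 1 →
      (1 - (β - 1) * lB) * PA * x ^ (Real.log (4 / 3) / Real.log 2) +
          (1 - (β - 1) * lA) * PB * (1 - x) ^ (Real.log (4 / 3) / Real.log 2) ≤
        (1 - β * lB) * PA + (1 - β * lA) * PB + (1 + ε) * lA * lB)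
    (T : PTree) (hT : Adm β Vmin R ℓmin T) :
    dev β T ≤ R * (1 + ε) / (ε * (2 * β - 1) * ℓmin ^ (Real.log (4 / 3) / Real.log 2)) *
      size T ^ (Real.log (4 / 3) / Real.log 2) := by
  set κ := Real.log (4 / 3) / Real.log 2 with hκ
  have h := tree_cap hβ hε hV0 hV1 hR hℓ hcrit T hT
  obtain ⟨⟨hl0, hl1⟩, _, _, hℓT⟩ := adm_invariants hβ hR hℓ T hT
  obtain ⟨hP0, hP1⟩ := pot_bounds hβ hR hℓ hε.le hV1 T hT
  have hsz : 0 < size T := lt_of_lt_of_le hℓ hℓT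
  have hS0 : 0 ≤ size T ^ κ := Real.rpow_nonneg hsz.le κ
  have hmin : 0 < ℓmin ^ κ := Real.rpow_pos_of_pos hℓ κ
  have hb1 : 0 < 2 * β - 1 := by linarith
  -- Φ ≤ (1+ε−V_min)λ ≤ (1+ε)/(2β−1)
  have hPle : pot β ε T ≤ (1 + ε) / (2 * β - 1) := by
    rw [le_div_iff₀ hb1]
    have : (1 + ε - Vmin) * share β T ≤ (1 + ε) * share β T :=
      mul_le_mul_of_nonneg_right (by linarith) hl0.le
    nlinarith
  have hU0 : 0 ≤ R / (ε * ℓmin ^ κ) := div_nonneg hR (mul_nonneg hε.le hmin.le)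
  calc dev β T ≤ R / (ε * ℓmin ^ κ) * pot β ε T * size T ^ κ := h
    _ ≤ R / (ε * ℓmin ^ κ) * ((1 + ε) / (2 * β - 1)) * size T ^ κ := by
        apply mul_le_mul_of_nonneg_right _ hS0
        exact mul_le_mul_of_nonneg_left hPle hU0
    _ = R * (1 + ε) / (ε * (2 * β - 1) * ℓmin ^ κ) * size T ^ κ := by
        congr 1
        field_simp

end Summit.MatrixMultiplication.MatrixMultiplication.Theorems.FarEdgeDescentTreeCap
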